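import Mathlib
import Summits.AnomalousDissipation.AnomalousDissipation.Theorems.SolenoidalFractalHomogenisationLagrangianStepW7CellSlot
import Summits.AnomalousDissipation.AnomalousDissipation.Theorems.SolenoidalFractalHomogenisationLagrangianStepW7Floor
import Summits.AnomalousDissipation.AnomalousDissipation.Theorems.SolenoidalFractalHomogenisationLagrangianStepW7ChainGeometry
import Summits.AnomalousDissipation.AnomalousDissipation.Theorems.SolenoidalFractalHomogenisationLagrangianStepCellChainSetup
import Summits.AnomalousDissipation.AnomalousDissipation.Theorems.SolenoidalFractalHomogenisationLagrangianStepCellChainBareDecay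
import Summits.AnomalousDissipation.AnomalousDissipation.Theorems.SolenoidalFractalHomogenisationLagrangianStepCellChainRegimeTools
import Summits.AnomalousDissipation.AnomalousDissipation.Theorems.SolenoidalFractalHomogenisationLagrangianStepOneLevelScales
import HarnessLib

/-!
# K1L_D (stmt-AnomalousDissipation-27980), W7 ENGINE (R-b)/(R-d) — THE NEAR-CLASS ENGINE `classDecayW_chain`
# (helper; `--supports stmt-AnomalousDissipation-27980 --as helper`)

`ClassDecayW cubatureWord M hM lo hi Λ β 1 Kb (exp 1) cK (near classes k̃ < 1/2)` with an explicit `ν`-uniform rate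
`cK = min κ₀ 1/(7440 M)`: for a weak solution of the tensor cell problem driven by the stretched cubature word whose data live on a
Bloch class pair with near representative `K₀` (`2‖K₀‖ < n`), ONE covering slot per period (`HighLabelDecay.coupledUnshielded_quant`)
contracts the energy by `e^{−κ₀}` (`W7Cell.cell_slot_contraction` with the numbers of `…W7ChainGeometry` and the parameter/floor of
`…W7Floor`), the energy is antitone, hence `W7Engine.profile_capped_on` gives `E t ≤ e·exp(−(min κ₀ 1/P) t)·E 0`, `P = 3720M/ν`.
Inputs from prover ad-k1l-cellLawV-w1 g4's S1a: `classDecayW_setup` (window, datum, energy package, class-pair confinement),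
`norm_latticeVec_ge_of_classPair_ne`, `windows_disjoint_of_two_norm_lt`.  Here: `chain_window_numbers`, `ae_gap_chain`,
`period_stretch_cubature`, **`classDecayW_chain`**.  W7 assembly owner: prover ad-sawtooth-k1loc-p1 g11.  No definitions, no sorry.
NOT a proof of the crux / of AD; rung F-D1.A0. [cite: BedrossianCotiZelati2017, Thm 1.1 / §2 (hypocoercivity, ν-uniform rate)] [problem: turb]
-/

set_option linter.dupNamespace false

noncomputable section

namespace Summit.AnomalousDissipation.AnomalousDissipation.Theorems.SolenoidalFractalHomogenisation.LagrangianStep.W7Cell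

open Set Real MeasureTheory intervalIntegral Filter Topology Function Complex UnitAddTorus
open scoped InnerProductSpace ComplexConjugate
open Literature.Analysis Literature.Analysis.FunctionSpaces Literature.Analysis.FunctionSpaces.Torus
open Literature.Analysis.FluidPDE Literature.Analysis.FluidPDE.Torus Literature.Analysis.FluidPDE.LatticeShear
open Summit.AnomalousDissipation.AnomalousDissipation.Theorems
open Summit.AnomalousDissipation.AnomalousDissipation.Theorems.SolenoidalFractalHomogenisation.RealisedQuasiStaticCellLaw
open Summit.AnomalousDissipation.AnomalousDissipation.Theorems.SolenoidalFractalHomogenisation.PermissibleCarrier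
  hiding trapezoid_nonneg trapezoid_le_one continuous_trapezoid
open Summit.AnomalousDissipation.AnomalousDissipation.Theorems.SolenoidalFractalHomogenisation.LagrangianStep
open Summit.AnomalousDissipation.AnomalousDissipation.Theorems.SolenoidalFractalHomogenisation.LagrangianStep.CellChain
open Summit.AnomalousDissipation.AnomalousDissipation.Theorems.SolenoidalFractalHomogenisation.LagrangianStep.W7Engine
open Summit.AnomalousDissipation.AnomalousDissipation.Theorems.SolenoidalFractalHomogenisation.LagrangianStep.W7Slot

/-! ## §1 Window numbers of the chain -/

/-- **The window numbers of the near chain.**  With `lo' = (1/n²)(νlo/Λ)`, `hi' = (1/n²)(νhiΛ)`, `β' = (1/n²)(νβ)`,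
`dmin = π²νlo/Λ`, `Dmax = 25π²ν(hiΛ + β/2)`: the six inequalities `hdp…hDm` of `cell_slot_contraction` and `dmin ≤ Dmax`. -/
theorem chain_window_numbers {K0 m : Fin 3 → ℤ} {n : ℕ} {ν lo hi Λ β : ℝ} (hn : 1 ≤ n) (hm : m ≠ 0) (hm3 : freqNormSq m ≤ 3)
    (hK0 : K0 ≠ 0) (h2 : 2 * ‖Torus.latticeVec K0‖ < n) (hν : 0 < ν) (hlo : 0 < lo) (hlo1 : lo ≤ 1) (hhi : 1 ≤ hi)
    (hΛ : 1 ≤ Λ) (hβ : 0 ≤ β) :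
    (∀ j : ℤ, j ≠ 0 → Real.pi ^ 2 * ν * lo / Λ
        ≤ 4 * Real.pi ^ 2 * ((1 / (n:ℝ) ^ 2) * (ν * (lo / Λ))) * freqNormSq (K0 + j • (fun i => m i * (n : ℤ)))) ∧
    (∀ j : ℤ, (j = 1 ∨ j = -1) →
        4 * Real.pi ^ 2 * ((1 / (n:ℝ) ^ 2) * (ν * (hi * Λ)) + (1 / (n:ℝ) ^ 2) * (ν * β) / 2)
          * freqNormSq (K0 + j • (fun i => m i * (n : ℤ))) ≤ 25 * Real.pi ^ 2 * ν * (hi * Λ + β / 2)) ∧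
    Real.pi ^ 2 * ν * lo / Λ ≤ 25 * Real.pi ^ 2 * ν * (hi * Λ + β / 2) := by
  have hn0 : (0:ℝ) < n := by exact_mod_cast hn
  have hΛ0 : 0 < Λ := by linarith
  have hπ : 0 < Real.pi ^ 2 := by positivity
  refine ⟨fun j hj => ?_, fun j hj => ?_, ?_⟩
  · have h := freqNormSq_chain_ge hn hm hK0 h2 hj
    calc Real.pi ^ 2 * ν * lo / Λ = 4 * Real.pi ^ 2 * ((1 / (n:ℝ) ^ 2) * (ν * (lo / Λ))) * ((n:ℝ) ^ 2 / 4) := by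
          field_simp
      _ ≤ 4 * Real.pi ^ 2 * ((1 / (n:ℝ) ^ 2) * (ν * (lo / Λ))) * freqNormSq (K0 + j • (fun i => m i * (n : ℤ))) :=
          mul_le_mul_of_nonneg_left h (by positivity)
  · have h := freqNormSq_chain_le (K0 := K0) h2 hm3 hj
    have hhb : 0 ≤ hi * Λ + β / 2 := by nlinarith
    calc 4 * Real.pi ^ 2 * ((1 / (n:ℝ) ^ 2) * (ν * (hi * Λ)) + (1 / (n:ℝ) ^ 2) * (ν * β) / 2)
          * freqNormSq (K0 + j • (fun i => m i * (n : ℤ)))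
        ≤ 4 * Real.pi ^ 2 * ((1 / (n:ℝ) ^ 2) * (ν * (hi * Λ)) + (1 / (n:ℝ) ^ 2) * (ν * β) / 2) * (25 / 4 * (n:ℝ) ^ 2) :=
          mul_le_mul_of_nonneg_left h (by positivity)
      _ = 25 * Real.pi ^ 2 * ν * (hi * Λ + β / 2) := by field_simp
  · have h1 : lo / Λ ≤ 1 := by rw [div_le_one hΛ0]; linarith
    have h2' : (1:ℝ) ≤ hi * Λ + β / 2 := by nlinarith
    have : Real.pi ^ 2 * ν * lo / Λ = Real.pi ^ 2 * ν * (lo / Λ) := by ring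
    rw [this]
    nlinarith [mul_pos hπ hν]

/-! ## §2 The gap off the ten-mode block -/

/-- **The gap hypothesis `hgap` of `cell_slot_contraction` for the near chain**: every carried mode off the block lies in the class pair
and differs from `±K₀`, so `|k|² ≥ n²/4` (`norm_latticeVec_ge_of_classPair_ne`) and `8π²·lo'·|k|² ≥ 2π²νlo/Λ ≥ dmin`. -/
theorem ae_gap_chain {T : ℝ} {u : ℝ → UnitAddTorus (Fin 3) → EuclideanSpace ℝ (Fin 3)} {ℓ K0 z₀ m : Fin 3 → ℤ} {n : ℕ}
    {ν lo Λ : ℝ} (hn : 1 ≤ n) (hν : 0 < ν) (hlo : 0 < lo) (hΛ : 1 ≤ Λ) (hK0def : K0 = ℓ + (n:ℤ) • z₀)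
    (h2 : 2 * ‖Torus.latticeVec K0‖ < n)
    (hclass : ∀ᵐ t ∂(volume.restrict (Ioo 0 T)), ∀ k' : Fin 3 → ℤ,
      (¬ ∃ z : Fin 3 → ℤ, k' = ℓ + (n : ℤ) • z) → (¬ ∃ z : Fin 3 → ℤ, k' = -ℓ + (n : ℤ) • z) →
      mFourierCoeff (FunctionSpaces.EuclideanSpace.complexify ∘ u t) k' = 0) :
    ∀ᵐ t ∂(volume.restrict (Ioo 0 T)), ∀ k : Fin 3 → ℤ,
      (∀ j ∈ ({-2, -1, 0, 1, 2} : Finset ℤ), k ≠ K0 + j • (fun i => m i * (n : ℤ)) ∧ k ≠ -(K0 + j • (fun i => m i * (n : ℤ)))) →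
      mFourierCoeff (EuclideanSpace.complexify ∘ u t) k ≠ 0 →
      Real.pi ^ 2 * ν * lo / Λ ≤ 8 * Real.pi ^ 2 * ((1 / (n:ℝ) ^ 2) * (ν * (lo / Λ))) * freqNormSq k := by
  have hn0 : (0:ℝ) < n := by exact_mod_cast hn
  have hΛ0 : 0 < Λ := by linarith
  filter_upwards [hclass] with t ht k hk hne
  -- `k` lies in the class pair of `ℓ`, i.e. of `K₀`
  have hmem : (∃ z : Fin 3 → ℤ, k = K0 + (n : ℤ) • z) ∨ (∃ z : Fin 3 → ℤ, k = -K0 + (n : ℤ) • z) := by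
    by_contra hcon
    rw [not_or, not_exists, not_exists] at hcon
    apply hne
    refine ht k ?_ ?_
    · rintro ⟨z, hz⟩
      exact hcon.1 (z - z₀) (by rw [hz, hK0def]; ext i; simp; ring)
    · rintro ⟨z, hz⟩
      exact hcon.2 (z + z₀) (by rw [hz, hK0def]; ext i; simp; ring)
  have hk0 := hk 0 (by simp)
  rw [zero_smul, add_zero] at hk0
  have hge := norm_latticeVec_ge_of_classPair_ne hmem hk0.1 hk0.2
  have hk2 : (n:ℝ) ^ 2 / 4 ≤ freqNormSq k := by
    rw [← Literature.Analysis.FunctionSpaces.Torus.norm_latticeVec_sq]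
    have hh : (n:ℝ) / 2 ≤ ‖Torus.latticeVec k‖ := by linarith [norm_nonneg (Torus.latticeVec K0)]
    have := pow_le_pow_left₀ (by positivity) hh 2
    linarith
  calc Real.pi ^ 2 * ν * lo / Λ ≤ 2 * (Real.pi ^ 2 * ν * lo / Λ) := by
        have : 0 ≤ Real.pi ^ 2 * ν * lo / Λ := by positivity
        linarith
    _ = 8 * Real.pi ^ 2 * ((1 / (n:ℝ) ^ 2) * (ν * (lo / Λ))) * ((n:ℝ) ^ 2 / 4) := by field_simp; ring
    _ ≤ 8 * Real.pi ^ 2 * ((1 / (n:ℝ) ^ 2) * (ν * (lo / Λ))) * freqNormSq k :=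
        mul_le_mul_of_nonneg_left hk2 (by positivity)

/-! ## §3 The stretched cubature word -/

/-- Period of the stretched cubature word: `P = (1/ν)·(M·3720)`. -/
theorem period_stretch_cubature (M : ℝ) (hM : 0 < M) (ν : ℝ) (hν : 0 < 1 / ν) :
    ((cubatureWord.stretch M hM).stretch (1 / ν) hν).period = 1 / ν * (M * 3720) := by
  rw [period_stretch', period_stretch', period_cubatureWord]


/-! ## §4 The near-class engine -/

/-- **THE NEAR-CLASS ENGINE** (W7, regime `k̃ < 1/2`): `ClassDecayW cubatureWord M hM lo hi Λ β 1 Kb (exp 1) cK (near classes)` with the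
`ν`-uniform rate `cK = min κ₀ 1/(7440 M)`, `κ₀ = κ₀(lo, hi, Λ, β, M, Kb, γ)` the uniform slot floor of `…W7Floor` at the coupling constant
`γ` of `HighLabelDecay.coupledUnshielded_quant`.  One covering slot per period contracts the energy by `e^{−κ₀}` (`cell_slot_contraction`);
`profile_capped_on` turns this into the exponential profile. [cite: BedrossianCotiZelati2017, Thm 1.1 / §2 (hypocoercivity, ν-uniform rate)] -/
theorem classDecayW_chain (M : ℝ) (hM : 0 < M) {lo hi Λ β Kb : ℝ} (hlo : 0 < lo) (hlo1 : lo ≤ 1) (hhi : 1 ≤ hi)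
    (hΛ : 1 < Λ) (hβ : 0 ≤ β) (hKb : 1 ≤ Kb) :
    ∃ cK > (0:ℝ), ClassDecayW cubatureWord M hM lo hi Λ β 1 Kb (Real.exp 1) cK
      (fun n _ ℓ => ∃ z : Fin 3 → ℤ, ‖Torus.latticeVec (ℓ + (n : ℤ) • z)‖ < 1 / 2 * n) := by
  obtain ⟨γ, hγ, hcu⟩ := HighLabelDecay.coupledUnshielded_quant
  have hΛ1 : 1 ≤ Λ := hΛ.le
  have hΛ0 : 0 < Λ := by linarith
  have hhi0 : 0 ≤ hi := by linarith
  have hhb : 0 < hi * Λ + β / 2 := by nlinarith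
  have hKb0 : 0 < Kb := by linarith
  obtain ⟨κ₀, hκ₀pos, hκ₀def⟩ : ∃ κ₀ : ℝ, 0 < κ₀ ∧ κ₀ = (min (min (Real.pi ^ 2 * lo * (γ / 15) * M * 40 / (216 * Λ))
          (lo * (γ / (216 * Kb ^ 2)) * (γ / 15) * M * 40 / (108 * 625 * Real.pi ^ 2 * Λ * (hi * Λ + β / 2) ^ 2)))
        (min (lo * (γ / 216) * (γ / 15) * M * 40 / (432 * Real.pi ^ 2 * Λ * (hi * Λ + β / 2) ^ 2))
          (7 * Real.pi ^ 2 * lo * (γ / 15) ^ 2 * M ^ 3 * 40 ^ 3 * (γ / (216 * Kb ^ 2)) / (46656 * Λ)))) :=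
    ⟨_, kappa0_pos hlo hΛ1 hhb hM hKb0 hγ, rfl⟩
  refine ⟨min κ₀ 1 / (7440 * M), by positivity, ?_⟩
  intro ν hν n hn 𝔸 hodd hwin L hL hKL ℓ hdist hnear F hF hsupp T hT u hu
  have hν0 : 0 < ν := hν.1
  have hν1 : ν ≤ 1 := hν.2.le
  have hn0 : (0:ℝ) < n := by exact_mod_cast hn
  obtain ⟨hN, ⟨hF2, hFi, hFdiv⟩, ⟨E, Q, hE0, hEform, hEcont, hEanti, hEac, hEae, hQint, hQnn, hEd, hQS, hcoer⟩, hclass, hrep⟩ :=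
    classDecayW_setup cubatureWord M hM hlo hhi0 hΛ1 hν0 hn hwin ℓ hF hsupp hT hu
  set W₁ : LatticeWord 26 := (cubatureWord.stretch M hM).stretch (1 / ν) (one_div_pos.mpr hν0) with hW₁
  have hu' : Torus.IsWeakTensorPassiveVectorOn 0 T ((1 / (n:ℝ) ^ 2) • 𝔸) (W₁.cell n) F u := by
    rw [hW₁, ← cellField_eq_cell]; exact hu
  have hodd' : Torus.OddSmall ((1 / (n:ℝ) ^ 2) • 𝔸) ((1 / (n:ℝ) ^ 2) * (ν * β)) := hodd.smul _
  have hlo'0 : 0 < ((1 / (n:ℝ) ^ 2) * (ν * (lo / Λ))) := by positivity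
  have hhi'0 : 0 ≤ (1 / (n:ℝ) ^ 2) * (ν * (hi * Λ)) := by positivity
  have hβ'0 : 0 ≤ (1 / (n:ℝ) ^ 2) * (ν * β) := by positivity
  -- the energy is nonnegative on `[0,T]`
  have hEnn : ∀ t ∈ Icc 0 T, 0 ≤ E t :=
    le_on_Icc_of_ae_le (f := fun _ => (0:ℝ)) (g := E) hT continuousOn_const hEcont
      (hEae.mono fun t ht => by rw [ht]; positivity)
  -- the near representative `K₀` of the class
  obtain ⟨z₀, hz₀⟩ := hnear
  obtain ⟨K0, hK0def⟩ : ∃ K0 : Fin 3 → ℤ, K0 = ℓ + (n : ℤ) • z₀ := ⟨_, rfl⟩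
  have hK0norm : ‖Torus.latticeVec K0‖ < 1 / 2 * n := by rw [hK0def]; exact hz₀
  have h2 : 2 * ‖Torus.latticeVec K0‖ < n := by linarith
  have hK0L : L ≤ ‖Torus.latticeVec K0‖ := by rw [hK0def]; exact hdist z₀
  have hK0n : 0 < ‖Torus.latticeVec K0‖ := lt_of_lt_of_le hL hK0L
  have hK0 : K0 ≠ 0 := by
    intro h; rw [h, latticeVec_zero, norm_zero] at hK0n; exact lt_irrefl _ hK0n
  have hdistK : ∀ z : Fin 3 → ℤ, L ≤ ‖Torus.latticeVec (K0 + (n : ℤ) • z)‖ := fun z => by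
    have e : K0 + (n : ℤ) • z = ℓ + (n : ℤ) • (z₀ + z) := by rw [hK0def, smul_add]; abel
    rw [e]; exact hdist _
  have hkt : ν / Kb ≤ ‖Torus.latticeVec K0‖ / n := by
    rw [div_le_div_iff₀ hKb0 hn0]
    calc ν * (n:ℝ) = (n:ℝ) * ν := mul_comm _ _
      _ ≤ Kb * L := hKL
      _ ≤ Kb * ‖Torus.latticeVec K0‖ := mul_le_mul_of_nonneg_left hK0L hKb0.le
      _ = ‖Torus.latticeVec K0‖ * Kb := mul_comm _ _
  have hkt0 : 0 < ‖Torus.latticeVec K0‖ / n := by positivity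
  -- the covering slot `j`
  have hunit : ‖(1 / ‖Torus.latticeVec K0‖) • Torus.latticeVec K0‖ = 1 := by
    rw [norm_smul, norm_div, norm_one, Real.norm_eq_abs, abs_of_pos hK0n, one_div, inv_mul_cancel₀ hK0n.ne']
  obtain ⟨j, hj⟩ := hcu _ hunit
  obtain ⟨hnv1, hnv6, hτ40, hm3i, hv2i⟩ := slots_ranges j
  have hphm : (W₁.phase j).m = (slots j).m := rfl
  have hphτ : (W₁.phase j).τ = 1 / ν * (M * ((slots j).τ : ℝ)) := rfl
  have hramp : W₁.ramp = 1 / 2 := rfl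
  have hP : W₁.period = 1 / ν * (M * 3720) := period_stretch_cubature M hM ν _
  have hP0 : 0 < W₁.period := by rw [hP]; positivity
  have hmne : (W₁.phase j).m ≠ 0 := (W₁.phase j).m_ne
  have hm3 : freqNormSq (W₁.phase j).m ≤ 3 := by
    rw [hphm, freqNormSq, Fin.sum_univ_three]; exact_mod_cast hm3i
  have hm2r : ((slots j).m 0 : ℝ) ^ 2 + ((slots j).m 1 : ℝ) ^ 2 + ((slots j).m 2 : ℝ) ^ 2 ≤ 3 := by exact_mod_cast hm3i
  have hv2r : ((slots j).v 0 : ℝ) ^ 2 + ((slots j).v 1 : ℝ) ^ 2 + ((slots j).v 2 : ℝ) ^ 2 ≤ 6 := by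
    have e : ((slots j).v 0 : ℝ) ^ 2 + ((slots j).v 1 : ℝ) ^ 2 + ((slots j).v 2 : ℝ) ^ 2 = ((slots j).n : ℝ) := by
      exact_mod_cast hv2i
    rw [e]; exact_mod_cast hnv6
  have hτ40r : (40:ℝ) ≤ ((slots j).τ : ℝ) := by exact_mod_cast hτ40
  obtain ⟨hcovV, hcovM⟩ := cuPoly_unpack hK0 j hv2r hm2r hj
  have hcovM' : γ / 6 * ‖Torus.latticeVec K0‖ ^ 2 ≤ (∑ i, (K0 i : ℝ) * (W₁.phase j).m i) ^ 2 := hcovM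
  -- the cell frequency and the ten-vector block
  have hKs : (fun i => (W₁.phase j).m i * (n : ℤ)) ≠ 0 := cellFreq_ne_zero (W₁.phase j) hn
  have hKs2 : 2 * ‖Torus.latticeVec K0‖ < ‖Torus.latticeVec (fun i => (W₁.phase j).m i * (n : ℤ))‖ := by
    rw [norm_cellFreq]
    have h1 := Torus.one_le_norm_latticeVec hmne
    calc 2 * ‖Torus.latticeVec K0‖ < (n:ℝ) := h2
      _ = (n:ℝ) * 1 := (mul_one _).symm
      _ ≤ (n:ℝ) * ‖Torus.latticeVec (W₁.phase j).m‖ := mul_le_mul_of_nonneg_left h1 hn0.le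
  have hKp : (K0 + (1:ℤ) • (fun i => (W₁.phase j).m i * (n : ℤ))) ≠ 0 := chain_ne_zero hL hdistK 1
  have hKm : (K0 + (-1:ℤ) • (fun i => (W₁.phase j).m i * (n : ℤ))) ≠ 0 := chain_ne_zero hL hdistK (-1)
  have hdisj : ∀ j₁ ∈ ({-2, -1, 0, 1, 2} : Finset ℤ), ∀ j₂ ∈ ({-2, -1, 0, 1, 2} : Finset ℤ),
      K0 + j₁ • (fun i => (W₁.phase j).m i * (n : ℤ)) ≠ -(K0 + j₂ • (fun i => (W₁.phase j).m i * (n : ℤ))) :=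
    fun j₁ _ j₂ _ => windows_disjoint_of_two_norm_lt hK0 hKs2 j₁ j₂
  -- the numbers
  obtain ⟨dmin, hdmin⟩ : ∃ x : ℝ, x = Real.pi ^ 2 * ν * lo / Λ := ⟨_, rfl⟩
  obtain ⟨Dmax, hDmax⟩ : ∃ x : ℝ, x = 25 * Real.pi ^ 2 * ν * (hi * Λ + β / 2) := ⟨_, rfl⟩
  have hdmin0 : 0 < dmin := by rw [hdmin]; positivity
  have hDmax0 : 0 < Dmax := by rw [hDmax]; positivity
  obtain ⟨hwlo, hwhi, hdD⟩ := chain_window_numbers (K0 := K0) (m := (W₁.phase j).m) (ν := ν) (lo := lo) (hi := hi) (Λ := Λ)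
    (β := β) hn hmne hm3 hK0 h2 hν0 hlo hlo1 hhi hΛ1 hβ
  have hdD' : dmin ≤ Dmax := by rw [hdmin, hDmax]; exact hdD
  have hK0sq : freqNormSq (K0 + (0:ℤ) • (fun i => (W₁.phase j).m i * (n : ℤ))) = ‖Torus.latticeVec K0‖ ^ 2 := freqNormSq_chain_zero K0 _ n
  have hd0pos : 0 < (4 * Real.pi ^ 2 * ((1 / (n:ℝ) ^ 2) * (ν * (lo / Λ))) * freqNormSq (K0 + (0:ℤ) • (fun i => (W₁.phase j).m i * (n : ℤ)))) := by rw [hK0sq]; positivity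
  have hD0pos : 0 < (4 * Real.pi ^ 2 * ((1 / (n:ℝ) ^ 2) * (ν * (hi * Λ)) + (1 / (n:ℝ) ^ 2) * (ν * β) / 2) * freqNormSq (K0 + (0:ℤ) • (fun i => (W₁.phase j).m i * (n : ℤ)))) := by
    rw [hK0sq]
    have : 0 < ((1 / (n:ℝ) ^ 2) * (ν * (hi * Λ)) + (1 / (n:ℝ) ^ 2) * (ν * β) / 2) := by positivity
    positivity
  have hd0eq : (4 * Real.pi ^ 2 * ((1 / (n:ℝ) ^ 2) * (ν * (lo / Λ))) * freqNormSq (K0 + (0:ℤ) • (fun i => (W₁.phase j).m i * (n : ℤ)))) = 4 * Real.pi ^ 2 * ν * lo * (‖Torus.latticeVec K0‖ / n) ^ 2 / Λ := by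
    rw [hK0sq]; field_simp
  have hD0eq : (4 * Real.pi ^ 2 * ((1 / (n:ℝ) ^ 2) * (ν * (hi * Λ)) + (1 / (n:ℝ) ^ 2) * (ν * β) / 2) * freqNormSq (K0 + (0:ℤ) • (fun i => (W₁.phase j).m i * (n : ℤ)))) = 4 * Real.pi ^ 2 * ν * (hi * Λ + β / 2) * (‖Torus.latticeVec K0‖ / n) ^ 2 := by
    rw [hK0sq]; field_simp
  have hτ'eq : (W₁.phase j).τ = M * ((slots j).τ : ℝ) / ν := by rw [hphτ]; field_simp
  have hτ'0 : 0 < (W₁.phase j).τ := (W₁.phase j).τ_pos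
  -- the link constant and the drain coefficient
  obtain ⟨c, hc⟩ : ∃ x : ℝ, x = |∑ a, (W₁.phase j).e a * (K0 a : ℝ)| * (1 / (n : ℝ)) / (2 * ‖Torus.latticeVec (W₁.phase j).m‖) :=
    ⟨_, rfl⟩
  obtain ⟨hc0, hc2⟩ := c_chain_bounds (K0 := K0) (m := (slots j).m) (v := (slots j).v) (n := n) (nv := (slots j).n) (γ := γ)
    (c := c) hn hmne hm3 hnv1 hnv6 hγ hK0 hcovV (by rw [hc]; rfl)
  obtain ⟨hq15, hq2⟩ := q_chain_bounds (K0 := K0) (m := (W₁.phase j).m) (n := n) hK0 h2 hm3 hγ.le hcovM'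
  have hq0 : 0 < (2 - (freqNormSq (fun i => (W₁.phase j).m i * (n : ℤ)) - (∑ i, (K0 i : ℝ) * (fun i => (W₁.phase j).m i * (n : ℤ)) i) ^ 2 / freqNormSq K0) * (1 / freqNormSq (K0 + (fun i => (W₁.phase j).m i * (n : ℤ))) + 1 / freqNormSq (K0 - (fun i => (W₁.phase j).m i * (n : ℤ))))) := lt_of_lt_of_le (by positivity) hq15
  have hqw : ∀ z : EuclideanSpace ℂ (Fin 3), kdot (K0 + (0:ℤ) • (fun i => (W₁.phase j).m i * (n : ℤ))) z = 0 →
      (2 - (freqNormSq (fun i => (W₁.phase j).m i * (n : ℤ)) - (∑ i, (K0 i : ℝ) * (fun i => (W₁.phase j).m i * (n : ℤ)) i) ^ 2 / freqNormSq K0) * (1 / freqNormSq (K0 + (fun i => (W₁.phase j).m i * (n : ℤ))) + 1 / freqNormSq (K0 - (fun i => (W₁.phase j).m i * (n : ℤ))))) * ‖z‖ ^ 2 ≤ ‖transversalProj (K0 + (1:ℤ) • (fun i => (W₁.phase j).m i * (n : ℤ))) z‖ ^ 2 + ‖transversalProj (K0 + (-1:ℤ) • (fun i => (W₁.phase j).m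 i * (n : ℤ))) z‖ ^ 2 :=
    fun z hz => hqw_chain K0 (fun i => (W₁.phase j).m i * (n : ℤ)) z hz
  -- the hypocoercivity parameter and the floor
  obtain ⟨ε, hε⟩ : ∃ x : ℝ, x = min (min (dmin / (8 * c ^ 2)) (dmin / (4 * Dmax ^ 2)))
      (min ((4 * Real.pi ^ 2 * ((1 / (n:ℝ) ^ 2) * (ν * (lo / Λ))) * freqNormSq (K0 + (0:ℤ) • (fun i => (W₁.phase j).m i * (n : ℤ)))) / (4 * (4 * Real.pi ^ 2 * ((1 / (n:ℝ) ^ 2) * (ν * (hi * Λ)) + (1 / (n:ℝ) ^ 2) * (ν * β) / 2) * freqNormSq (K0 + (0:ℤ) • (fun i => (W₁.phase j).m i * (n : ℤ)))) ^ 2)) (7 * (2 - (freqNormSq (fun i => (W₁.phase j).m i * (n : ℤ)) - (∑ i, (K0 i : ℝ) * (fun i => (W₁.phase j).m i * (n : ℤ)) i) ^ 2 / freqNormSq K0) * (1 / freqNormSq (K0 + (fun i => (W₁.phase j).m i * (n : ℤ))) + 1 / freqNormSq (K0 - (fun i => (W₁.phase j).m i * (n : ℤ))))) * dmin * (W₁.phase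 j).τ ^ 2 / 1728)) := ⟨_, rfl⟩
  obtain ⟨hε0, c1, c2, c3, c4, c5⟩ := floor_caps hdmin0 hDmax0 hd0pos hD0pos hτ'0 hq0 hc0 hε
  have hfloor := floor_uniform (β := β) hν0 hν1 hlo hΛ1 hhb hM hKb0 hγ hkt hkt0 hτ40r hq15 hc0 hc2 hdmin hDmax hd0eq hD0eq hτ'eq hε
  rw [← hκ₀def] at hfloor
  -- the gap off the block
  have hgap : ∀ᵐ t ∂(volume.restrict (Ioo 0 T)), ∀ k : Fin 3 → ℤ,
      (∀ j' ∈ ({-2, -1, 0, 1, 2} : Finset ℤ), k ≠ K0 + j' • (fun i => (W₁.phase j).m i * (n : ℤ)) ∧ k ≠ -(K0 + j' • (fun i => (W₁.phase j).m i * (n : ℤ)))) →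
      mFourierCoeff (EuclideanSpace.complexify ∘ u t) k ≠ 0 → dmin ≤ 8 * Real.pi ^ 2 * ((1 / (n:ℝ) ^ 2) * (ν * (lo / Λ))) * freqNormSq k := by
    rw [hdmin]; exact ae_gap_chain (m := (W₁.phase j).m) hn hν0 hlo hΛ1 hK0def h2 hclass
  -- ONE PERIOD: the covering slot contracts by `e^{−κ₀}`, the energy is antitone elsewhere
  have hs0 := start_nonneg W₁ j
  have hsP := start_add_tau_le_period W₁ j
  have hper : ∀ p : ℕ, (0:ℝ) + (p + 1) * W₁.period ≤ T →
      E (0 + (p + 1) * W₁.period) ≤ Real.exp (-κ₀) * E (0 + p * W₁.period) := by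
    intro p hp
    have hpP : 0 ≤ (p:ℝ) * W₁.period := by positivity
    have ht₀ : 0 ≤ ((p:ℤ):ℝ) * W₁.period + W₁.start j := by push_cast; positivity
    have ht₁ : ((p:ℤ):ℝ) * W₁.period + W₁.start j + (W₁.phase j).τ ≤ T := by push_cast; linarith
    have hstep := cell_slot_contraction W₁ n hT hN hlo'0 hhi'0 hodd' hβ'0 hFi hu' hramp hEcont hEac hEae hEd hQS j (p:ℤ)
      ht₀ ht₁ K0 hKs hKp hKm hdisj hdmin0 hdmin0.le hε0 hq0.le hq2 hc
      (by rw [hdmin]; exact hwlo 1 one_ne_zero) (by rw [hdmin]; exact hwlo (-1) (by norm_num))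
      (by rw [hdmin]; exact hwlo 2 (by norm_num)) (by rw [hdmin]; exact hwlo (-2) (by norm_num))
      (by rw [hDmax]; exact hwhi 1 (Or.inl rfl)) (by rw [hDmax]; exact hwhi (-1) (Or.inr rfl)) hdD'
      c1 c2 c3 c4 c5 hqw hgap
    have hw0 : (0:ℝ) + p * W₁.period ≤ ((p:ℤ):ℝ) * W₁.period + W₁.start j := by push_cast; linarith
    have hw1 : ((p:ℤ):ℝ) * W₁.period + W₁.start j + (W₁.phase j).τ ≤ 0 + (p + 1) * W₁.period := by push_cast; linarith
    have hI0 : (0:ℝ) + p * W₁.period ∈ Icc 0 T := ⟨by linarith, by linarith⟩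
    have hIw0 : ((p:ℤ):ℝ) * W₁.period + W₁.start j ∈ Icc 0 T := ⟨ht₀, by linarith⟩
    have hIw1 : ((p:ℤ):ℝ) * W₁.period + W₁.start j + (W₁.phase j).τ ∈ Icc 0 T := ⟨by linarith, ht₁⟩
    have hI1 : (0:ℝ) + (p + 1) * W₁.period ∈ Icc 0 T := ⟨by linarith, hp⟩
    have hEw0 : 0 ≤ E (((p:ℤ):ℝ) * W₁.period + W₁.start j) := hEnn _ hIw0
    calc E (0 + (p + 1) * W₁.period) ≤ E (((p:ℤ):ℝ) * W₁.period + W₁.start j + (W₁.phase j).τ) := hEanti hIw1 hI1 hw1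
      _ ≤ Real.exp (-(ε * c ^ 2 * (2 - (freqNormSq (fun i => (W₁.phase j).m i * (n : ℤ)) - (∑ i, (K0 i : ℝ) * (fun i => (W₁.phase j).m i * (n : ℤ)) i) ^ 2 / freqNormSq K0) * (1 / freqNormSq (K0 + (fun i => (W₁.phase j).m i * (n : ℤ))) + 1 / freqNormSq (K0 - (fun i => (W₁.phase j).m i * (n : ℤ))))) * (W₁.phase j).τ / 27)) * E (((p:ℤ):ℝ) * W₁.period + W₁.start j) := hstep
      _ ≤ Real.exp (-κ₀) * E (((p:ℤ):ℝ) * W₁.period + W₁.start j) :=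
          mul_le_mul_of_nonneg_right (Real.exp_le_exp.2 (by linarith)) hEw0
      _ ≤ Real.exp (-κ₀) * E (0 + p * W₁.period) := mul_le_mul_of_nonneg_left (hEanti hI0 hIw0 hw0) (Real.exp_pos _).le
  -- the profile
  filter_upwards [hEae, ae_restrict_mem measurableSet_Ioo] with t hEt htI
  rw [← hEt, ← hE0]
  have hprof := profile_capped_on hP0 hκ₀pos.le hEanti hEnn hper (Ioo_subset_Icc_self htI)
  have e : -(min κ₀ 1 / W₁.period) * (t - 0) = -(2 * (min κ₀ 1 / (7440 * M)) * ν * t) := by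
    rw [hP]; field_simp; ring
  rw [e] at hprof
  exact hprof


/-! ## §5 All classes: near engine ⊕ far (bare) engine -/

/-- **`ClassDecayW` FOR ALL CLASSES of the cubature cell problem**, `ν₀ = 1`, `CK = e`, explicit `cK > 0`: the near-class engine
`classDecayW_chain` (k̃ < 1/2) spliced with prover ad-k1l-cellLawV-w1 g4's bare far-class engine `classDecayW_bare` (k̃ ≥ 1/2) by
`classDecayW_split_kt`. [cite: BedrossianCotiZelati2017, Thm 1.1 / §2 (hypocoercivity, ν-uniform rate)] -/
theorem classDecayW_cubature_all (M : ℝ) (hM : 0 < M) {lo hi Λ β Kb : ℝ} (hlo : 0 < lo) (hlo1 : lo ≤ 1) (hhi : 1 ≤ hi)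
    (hΛ : 1 < Λ) (hβ : 0 ≤ β) (hKb : 1 ≤ Kb) :
    ∃ cK > (0:ℝ), ClassDecayW cubatureWord M hM lo hi Λ β 1 Kb (Real.exp 1) cK admAll := by
  obtain ⟨cK₁, hcK₁, h₁⟩ := classDecayW_chain M hM hlo hlo1 hhi hΛ hβ hKb
  have hΛ0 : 0 < Λ := by linarith
  have h₂ := classDecayW_bare cubatureWord M hM (hi := hi) hlo (by linarith) hΛ.le β 1 Kb (κ := 1 / 2) (by norm_num)
  have h := classDecayW_split_kt (1 / 2) (Real.exp_pos 1).le h₁ h₂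
  have h1e : (1:ℝ) ≤ Real.exp 1 := Real.one_le_exp (by norm_num)
  rw [min_self, max_eq_left h1e] at h
  exact ⟨_, lt_min hcK₁ (by positivity), h⟩

end Summit.AnomalousDissipation.AnomalousDissipation.Theorems.SolenoidalFractalHomogenisation.LagrangianStep.W7Cell

end
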